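import Summits.CriticalPhenomena.PercolationContinuityZ3.Theorems.PercNearOneGluingNoHeavyQuantGatedCatHull
import HarnessLib

/-!
# QUANT lane R8, T-DEC: CATERPILLAR LAWS WITH TINY SUPPORT — a caterpillar law living on `{0,4}`, `{0,1,5}` or `{1,2,6}` is pinned to an
# explicit one- or two-parameter region (`A₄(x)`, `F₅(x)`); support bookkeeping under `slice` / `gate`

builds on p205010 (kernel theorem, internal audit signed; external expert review pending)

Support file (`--supports stmt-CriticalPhenomena-4575`), QUANT lane census seat prim-quant-census-2 (gen 78), rung R8 of
`run/shared/lean/prim/quant/LADDER.md`.  Theorems only; standard axioms, no sorries.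

WHY.  The offset value bound of `…QuantCatHullValueBound` (`CatValueBound.leaf`) asks, for a blob of `a` relays with gate `g < 1` hung beside a
sub-caterpillar `ν` at offset `u`, that the support of `ν` fit in the target support `S` at BOTH offsets `u` and `u + a`.  For the corner target
`S = supp lpT = {0,1,2,5,6,10}` (census-2 g77/g78) this double condition leaves only TINY supports: `{0,4}` (`(u,a) ∈ {(1,1),(1,5),(2,4)}`), `{0,1,5}`
(`(0,1),(0,5),(1,4)`), `{1,2,6}` (`(0,4)`) or a single point — and a caterpillar law on such a support is NOT arbitrary: census-2 g78's classification
(memo `run/shared/lean/prim/quant/prim-quant-census-2-g78/BELLMAN-G78.md` §2), typed here by induction on `CatBuilt`: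
* `catBuilt_supp04`: support `⊆ {0,4}` at floor `x` ⟹ `ν 4 = 0 ∨ x ≤ ν 4` (the region `A₄(x)`: a blob of 4 relays is absent or has marginal `≥ x`);
* `catBuilt_supp015`: support `⊆ {0,1,5}` ⟹ `(ν 5 = 0 ∨ x ≤ ν 5) ∧ (ν 5 = 0 → ν 1 = 0 ∨ x ≤ ν 1)` (the region `F₅(x)`: with the heavy blob present
  the light relay's mass is FREE — it is the gated root `R¹[q](R⁴[·])` — without it the relay is itself a blob);
* `catBuilt_supp126`: support `⊆ {1,2,6}` ⟹ the same for `(ν 2, ν 6)` (a sure relay in front);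
* bookkeeping: `law_point_mass` (support in a point ⟹ that atom has mass 1), `law_supp_nonempty`, `law_sum_supp` / `law_wsum_supp` (sums over the
  range are sums over any finset containing the support), `slice_ne_zero_left/right`, `gate_ne_zero`, `gate_zero_ne_zero`.
These regions are EXACTLY the caterpillar laws on those supports (every point of `A₄(x)` / `F₅(x)` is attained: `blob(4,p)`, `gate_q(δ₁ ∗ blob(4,p₅/q))`,
…), which is why the census-2 g78 value recursion built on them reproduces census-2 g77's exhaustive 189-family bound to 6 digits; only the
inclusion "law ⟹ region" is needed for the kernel certificate and only it is proved here.
HONEST STATUS.  Classification lemmas; nothing is refuted here; `TreeBuiltCatHullLight`, `CatPairLight`, `SiblingStep`, `FarTreeRow` keep their ledger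
status; RATE class log\* / honest sentence of `run/shared/lean/prim/quant/README.md` unchanged.  [this work]; caterpillars: prim-quant-stmt g41
(`…QuantGatedCatHull`).  Nothing here is cited as a published result.  The gluing rows served [cite: KozmaNitzan2024, Conjecture 3 (p. 15)]; product
measure [cite: Grimmett1999, §1.3 p. 10].
-/

noncomputable section

open scoped BigOperators

namespace Summit.CriticalPhenomena.PercolationContinuityZ3.Theorems
namespace Quant
namespace LawDec

open Finset

/-! ### Law bookkeeping on a prescribed support -/

/-- a sum `Σ_{h ≤ N} f h · ν h` over the range equals the sum over any finset `D` containing the support of `ν` (`ν` vanishing above `N`).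
[folklore] -/
theorem law_wsum_supp (f : ℕ → ℝ) {N : ℕ} {ν : ℕ → ℝ} (hN : ∀ h, N < h → ν h = 0) {D : Finset ℕ} (hD : ∀ h, ν h ≠ 0 → h ∈ D) :
    ∑ h ∈ Finset.range (N + 1), f h * ν h = ∑ h ∈ D, f h * ν h := by
  have e1 : ∑ h ∈ Finset.range (N + 1), f h * ν h = ∑ h ∈ Finset.range (N + 1) ∩ D, f h * ν h := by
    rw [← Finset.sum_subset Finset.inter_subset_left]
    intro h _ hnot
    have : ν h = 0 := by
      by_contra hc
      exact hnot (Finset.mem_inter.2 ⟨‹h ∈ Finset.range (N + 1)›, hD h hc⟩)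
    rw [this, mul_zero]
  have e2 : ∑ h ∈ D, f h * ν h = ∑ h ∈ Finset.range (N + 1) ∩ D, f h * ν h := by
    rw [← Finset.sum_subset Finset.inter_subset_right]
    intro h hDm hnot
    have : ν h = 0 := by
      by_contra hc
      refine hnot (Finset.mem_inter.2 ⟨Finset.mem_range.2 ?_, hDm⟩)
      by_contra hr
      exact hc (hN h (by omega))
    rw [this, mul_zero]
  rw [e1, e2]

/-- the mass over the range is the mass over any finset containing the support. [folklore] -/
theorem law_sum_supp {N : ℕ} {ν : ℕ → ℝ} (hN : ∀ h, N < h → ν h = 0) {D : Finset ℕ} (hD : ∀ h, ν h ≠ 0 → h ∈ D) :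
    ∑ h ∈ Finset.range (N + 1), ν h = ∑ h ∈ D, ν h := by
  have := law_wsum_supp (fun _ => (1 : ℝ)) hN hD
  simpa using this

/-- a law of mass `1` supported in a single point `c` puts mass `1` there. [folklore] -/
theorem law_point_mass {N : ℕ} {ν : ℕ → ℝ} (hN : ∀ h, N < h → ν h = 0) (h1 : ∑ h ∈ Finset.range (N + 1), ν h = 1)
    {c : ℕ} (hc : ∀ h, ν h ≠ 0 → h = c) : ν c = 1 := by
  have := law_sum_supp hN (D := {c}) (fun h hh => by rw [Finset.mem_singleton]; exact hc h hh)
  rw [h1, Finset.sum_singleton] at this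
  exact this.symm

/-- a law of mass `1` has nonempty support. [folklore] -/
theorem law_supp_nonempty {N : ℕ} {ν : ℕ → ℝ} (hN : ∀ h, N < h → ν h = 0) (h1 : ∑ h ∈ Finset.range (N + 1), ν h = 1)
    (hc : ∀ h, ν h ≠ 0 → False) : False := by
  have := law_sum_supp hN (D := ∅) (fun h hh => (hc h hh).elim)
  rw [h1, Finset.sum_empty] at this
  exact one_ne_zero this

/-- mass bookkeeping on the two-point support `{0,4}`. [folklore] -/
theorem law_mass_04 {N : ℕ} {ν : ℕ → ℝ} (hN : ∀ h, N < h → ν h = 0) (h1 : ∑ h ∈ Finset.range (N + 1), ν h = 1)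
    (hD : ∀ h, ν h ≠ 0 → h = 0 ∨ h = 4) : ν 0 + ν 4 = 1 := by
  have := law_sum_supp hN (D := {0, 4}) (fun h hh => by
    rcases hD h hh with rfl | rfl <;> simp)
  rw [h1, Finset.sum_pair (by norm_num)] at this
  exact this.symm

/-! ### Support bookkeeping under `gate` and `slice` -/

/-- an atom of `ν` is an atom of `gate ν q` (`q > 0`, `ν ≥ 0`). [this work] -/
theorem gate_ne_zero {ν : ℕ → ℝ} (hν : ∀ h, 0 ≤ ν h) {q : ℝ} (hq : 0 < q) (hq1 : q ≤ 1) {h : ℕ} (hh : ν h ≠ 0) :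
    gate ν q h ≠ 0 := by
  have hpos : 0 < ν h := lt_of_le_of_ne (hν h) (Ne.symm hh)
  simp only [gate]
  intro hc
  by_cases h0 : h = 0
  · rw [if_pos h0] at hc; nlinarith
  · rw [if_neg h0] at hc; nlinarith

/-- a proper gate has an atom at `0`. [this work] -/
theorem gate_zero_ne_zero {ν : ℕ → ℝ} (hν : ∀ h, 0 ≤ ν h) {q : ℝ} (hq0 : 0 ≤ q) (hq : q < 1) : gate ν q 0 ≠ 0 := by
  simp only [gate, if_true]
  intro hc; nlinarith [hν 0]

/-- an atom of `ν` is an atom of `slice ν a g` when `g < 1` (`ν ≥ 0`, `g ≥ 0`). [this work] -/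
theorem slice_ne_zero_left {ν : ℕ → ℝ} (hν : ∀ h, 0 ≤ ν h) {a : ℕ} {g : ℝ} (hg0 : 0 ≤ g) (hg : g < 1) {h : ℕ} (hh : ν h ≠ 0) :
    slice ν a g h ≠ 0 := by
  have hpos : 0 < ν h := lt_of_le_of_ne (hν h) (Ne.symm hh)
  simp only [slice]
  have : 0 ≤ (if a ≤ h then ν (h - a) else 0 : ℝ) := by split_ifs; exacts [hν _, le_rfl]
  intro hc; nlinarith

/-- an atom `h` of `ν` gives the atom `h + a` of `slice ν a g` when `g > 0` (`ν ≥ 0`, `g ≤ 1`). [this work] -/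
theorem slice_ne_zero_right {ν : ℕ → ℝ} (hν : ∀ h, 0 ≤ ν h) {a : ℕ} {g : ℝ} (hg0 : 0 < g) (hg1 : g ≤ 1) {h : ℕ} (hh : ν h ≠ 0) :
    slice ν a g (h + a) ≠ 0 := by
  have hpos : 0 < ν h := lt_of_le_of_ne (hν h) (Ne.symm hh)
  simp only [slice, Nat.le_add_left, if_true, Nat.add_sub_cancel]
  intro hc; nlinarith [hν (h + a)]

/-- value of a slice at an atom below the blob size: `slice ν a g h = (1 − g)·ν h` for `h < a`. [this work] -/
theorem slice_apply_lt (ν : ℕ → ℝ) (a : ℕ) (g : ℝ) {h : ℕ} (hh : h < a) : slice ν a g h = (1 - g) * ν h := by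
  simp only [slice, if_neg (not_le.2 hh), mul_zero, add_zero]

/-- value of a slice at an atom at or above the blob size: `slice ν a g h = (1 − g)·ν h + g·ν (h − a)` for `a ≤ h`. [this work] -/
theorem slice_apply_ge (ν : ℕ → ℝ) (a : ℕ) (g : ℝ) {h : ℕ} (hh : a ≤ h) : slice ν a g h = (1 - g) * ν h + g * ν (h - a) := by
  simp only [slice, if_pos hh]

/-- the trivial slice `a = 0`. [this work] -/
theorem slice_zero_eq (ν : ℕ → ℝ) (g : ℝ) : slice ν 0 g = ν := by
  funext h; simp only [slice, Nat.zero_le, if_true, Nat.sub_zero]; ring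

/-! ### Support `{0,4}`: the region `A₄(x)` -/

/-- **A CATERPILLAR LAW ON `{0,4}` IS `(1−p)·δ₀ + p·δ₄` WITH `p = 0` OR `p ≥` THE FLOOR.** [this work] -/
theorem catBuilt_supp04 {x : ℝ} {N : ℕ} {ν : ℕ → ℝ} (h : CatBuilt x N ν) :
    (∀ k, ν k ≠ 0 → k = 0 ∨ k = 4) → ν 4 = 0 ∨ x ≤ ν 4 := by
  induction h with
  | nil x₀ hx0 hx1 => intro _; left; simp
  | @mono x₀ x' M₀ μ₀ h₀ hx'0 hxx ih =>
    intro hs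
    rcases ih hs with h4 | h4
    · exact Or.inl h4
    · exact Or.inr (hxx.trans h4)
  | @gate x₀ M₀ μ₀ h₀ q hq0 hq1 ih =>
    intro hs
    have f0 := h₀.lawFacts.1
    have hs' : ∀ k, μ₀ k ≠ 0 → k = 0 ∨ k = 4 := fun k hk => hs k (gate_ne_zero f0 hq0 hq1 hk)
    have e4 : gate μ₀ q 4 = q * μ₀ 4 := by simp [gate]
    rw [e4]
    rcases ih hs' with h4 | h4
    · left; rw [h4, mul_zero]
    · right; exact mul_le_mul_of_nonneg_left h4 hq0.le
  | @slice x₀ M₀ μ₀ h₀ a g hxg hg1 ih =>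
    intro hs
    obtain ⟨f0, fM, f1, _⟩ := h₀.lawFacts
    have hx0 : 0 < x₀ := h₀.floor.1
    have hx1 : x₀ < 1 := h₀.floor.2
    have hg0 : 0 < g := hx0.trans_le hxg
    obtain rfl | ha := Nat.eq_zero_or_pos a
    · rw [slice_zero_eq] at hs ⊢; exact ih hs
    rcases eq_or_lt_of_le hg1 with rfl | hg
    · -- sure blob of `a` relays: the law is `μ₀` shifted by `a`
      have hsh : ∀ k, μ₀ k ≠ 0 → k + a = 0 ∨ k + a = 4 := fun k hk => hs (k + a) (slice_ne_zero_right f0 one_pos le_rfl hk)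
      by_cases ha4 : a ≤ 4
      · right
        rw [slice_apply_ge _ _ _ ha4]
        have hpt : μ₀ (4 - a) = 1 := law_point_mass fM f1 fun k hk => by rcases hsh k hk with h | h <;> omega
        rw [hpt]; linarith
      · left
        rw [slice_apply_lt _ _ _ (by omega)]; ring
    · -- gated blob: both `μ₀` and its shift live inside `{0,4}`, which forces `a = 4` and `μ₀ = δ₀`
      have hboth : ∀ k, μ₀ k ≠ 0 → (k = 0 ∨ k = 4) ∧ (k + a = 0 ∨ k + a = 4) :=
        fun k hk => ⟨hs k (slice_ne_zero_left f0 hg0.le hg hk), hs (k + a) (slice_ne_zero_right f0 hg0 hg1 hk)⟩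
      by_cases ha4 : a = 4
      · subst ha4
        have hpt : μ₀ 0 = 1 := law_point_mass fM f1 fun k hk => by rcases hboth k hk with ⟨h | h, h' | h'⟩ <;> omega
        have h40 : μ₀ 4 = 0 := by
          by_contra hc; rcases hboth 4 hc with ⟨_, h' | h'⟩ <;> omega
        right
        rw [slice_apply_ge _ _ _ le_rfl, Nat.sub_self, hpt, h40]; linarith
      · exfalso
        exact law_supp_nonempty fM f1 fun k hk => by rcases hboth k hk with ⟨h | h, h' | h'⟩ <;> omega

/-! ### Support `{0,1,5}`: the region `F₅(x)` -/

/-- **A CATERPILLAR LAW ON `{0,1,5}`**: the heavy atom is absent or has mass `≥` the floor, and when it is absent the light atom is absent or has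
mass `≥` the floor (when the heavy blob is present the light relay is a gated root and its mass is free). [this work] -/
theorem catBuilt_supp015 {x : ℝ} {N : ℕ} {ν : ℕ → ℝ} (h : CatBuilt x N ν) :
    (∀ k, ν k ≠ 0 → k = 0 ∨ k = 1 ∨ k = 5) → (ν 5 = 0 ∨ x ≤ ν 5) ∧ (ν 5 = 0 → ν 1 = 0 ∨ x ≤ ν 1) := by
  induction h with
  | nil x₀ hx0 hx1 => intro _; simp
  | @mono x₀ x' M₀ μ₀ h₀ hx'0 hxx ih =>
    intro hs
    obtain ⟨h5, h1⟩ := ih hs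
    refine ⟨?_, fun hz => ?_⟩
    · rcases h5 with h5 | h5
      · exact Or.inl h5
      · exact Or.inr (hxx.trans h5)
    · rcases h1 hz with h1 | h1
      · exact Or.inl h1
      · exact Or.inr (hxx.trans h1)
  | @gate x₀ M₀ μ₀ h₀ q hq0 hq1 ih =>
    intro hs
    have f0 := h₀.lawFacts.1
    have hs' : ∀ k, μ₀ k ≠ 0 → k = 0 ∨ k = 1 ∨ k = 5 := fun k hk => hs k (gate_ne_zero f0 hq0 hq1 hk)
    obtain ⟨h5, h1⟩ := ih hs'
    have e5 : gate μ₀ q 5 = q * μ₀ 5 := by simp [gate]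
    have e1 : gate μ₀ q 1 = q * μ₀ 1 := by simp [gate]
    rw [e5, e1]
    refine ⟨?_, fun hz => ?_⟩
    · rcases h5 with h5 | h5
      · left; rw [h5, mul_zero]
      · right; exact mul_le_mul_of_nonneg_left h5 hq0.le
    · have hz' : μ₀ 5 = 0 := by
        rcases mul_eq_zero.1 hz with hq | hμ
        · exact absurd hq hq0.ne'
        · exact hμ
      rcases h1 hz' with h1 | h1
      · left; rw [h1, mul_zero]
      · right; exact mul_le_mul_of_nonneg_left h1 hq0.le
  | @slice x₀ M₀ μ₀ h₀ a g hxg hg1 ih =>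
    intro hs
    obtain ⟨f0, fM, f1, _⟩ := h₀.lawFacts
    have hx0 : 0 < x₀ := h₀.floor.1
    have hx1 : x₀ < 1 := h₀.floor.2
    have hg0 : 0 < g := hx0.trans_le hxg
    obtain rfl | ha := Nat.eq_zero_or_pos a
    · rw [slice_zero_eq] at hs ⊢; exact ih hs
    rcases eq_or_lt_of_le hg1 with rfl | hg
    · -- sure blob of `a ≥ 1` relays in front of `μ₀`
      have hsh : ∀ k, μ₀ k ≠ 0 → k + a = 0 ∨ k + a = 1 ∨ k + a = 5 := fun k hk => hs (k + a) (slice_ne_zero_right f0 one_pos le_rfl hk)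
      have v1 : slice μ₀ a 1 1 = if a ≤ 1 then μ₀ (1 - a) else 0 := by simp only [slice]; ring
      have v5 : slice μ₀ a 1 5 = if a ≤ 5 then μ₀ (5 - a) else 0 := by simp only [slice]; ring
      rw [v1, v5]
      by_cases ha1 : a = 1
      · -- `μ₀` lives on `{0,4}`: region A₄
        subst ha1
        simp only [le_refl, if_true, show (1 : ℕ) ≤ 5 by norm_num, Nat.sub_self, show 5 - 1 = 4 by norm_num]
        have hs04 : ∀ k, μ₀ k ≠ 0 → k = 0 ∨ k = 4 := fun k hk => by rcases hsh k hk with h | h | h <;> omega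
        have h4 := catBuilt_supp04 h₀ hs04
        have hm := law_mass_04 fM f1 hs04
        refine ⟨h4, fun hz => Or.inr ?_⟩
        rw [hz, add_zero] at hm; rw [hm]; exact hx1.le
      · -- `a ≥ 2`: no mass at `1`; all the mass sits at `5`
        rw [if_neg (show ¬ a ≤ 1 by omega)]
        by_cases ha5 : a ≤ 5
        · rw [if_pos ha5]
          have hpt : μ₀ (5 - a) = 1 := law_point_mass fM f1 fun k hk => by rcases hsh k hk with h | h | h <;> omega
          rw [hpt]
          exact ⟨Or.inr hx1.le, fun hz => absurd hz one_ne_zero⟩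
        · rw [if_neg ha5]; simp
    · -- gated blob: `μ₀` and its shift both inside `{0,1,5}` ⟹ `a ∈ {1,4,5}` and `μ₀` is a point mass
      have hboth : ∀ k, μ₀ k ≠ 0 → (k = 0 ∨ k = 1 ∨ k = 5) ∧ (k + a = 0 ∨ k + a = 1 ∨ k + a = 5) :=
        fun k hk => ⟨hs k (slice_ne_zero_left f0 hg0.le hg hk), hs (k + a) (slice_ne_zero_right f0 hg0 hg1 hk)⟩
      have v1 : slice μ₀ a g 1 = (1 - g) * μ₀ 1 + g * (if a ≤ 1 then μ₀ (1 - a) else 0) := by simp only [slice]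
      have v5 : slice μ₀ a g 5 = (1 - g) * μ₀ 5 + g * (if a ≤ 5 then μ₀ (5 - a) else 0) := by simp only [slice]
      rw [v1, v5]
      obtain rfl | rfl | rfl | hother : a = 1 ∨ a = 4 ∨ a = 5 ∨ (a ≠ 1 ∧ a ≠ 4 ∧ a ≠ 5) := by omega
      · -- a = 1: μ₀ = δ₀
        have hpt : μ₀ 0 = 1 := law_point_mass fM f1 fun k hk => by rcases hboth k hk with ⟨h | h | h, h' | h' | h'⟩ <;> omega
        have z1 : μ₀ 1 = 0 := by by_contra hc; rcases hboth 1 hc with ⟨_, h' | h' | h'⟩ <;> omega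
        have z5 : μ₀ 5 = 0 := by by_contra hc; rcases hboth 5 hc with ⟨_, h' | h' | h'⟩ <;> omega
        have z4 : μ₀ 4 = 0 := by by_contra hc; rcases hboth 4 hc with ⟨h | h | h, _⟩ <;> omega
        simp only [le_refl, if_true, Nat.sub_self, show (1 : ℕ) ≤ 5 by norm_num, show 5 - 1 = 4 by norm_num, z1, z5, z4, hpt]
        refine ⟨Or.inl (by ring), fun _ => Or.inr (by linarith)⟩
      · -- a = 4: μ₀ = δ₁
        have hpt : μ₀ 1 = 1 := law_point_mass fM f1 fun k hk => by rcases hboth k hk with ⟨h | h | h, h' | h' | h'⟩ <;> omega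
        have z5 : μ₀ 5 = 0 := by by_contra hc; rcases hboth 5 hc with ⟨_, h' | h' | h'⟩ <;> omega
        simp only [show ¬ (4 : ℕ) ≤ 1 by norm_num, if_false, show (4 : ℕ) ≤ 5 by norm_num, if_true, show 5 - 4 = 1 by norm_num, z5, hpt]
        refine ⟨Or.inr (by linarith), fun hz => ?_⟩
        exfalso; have : g = 0 := by linarith
        exact hg0.ne' this
      · -- a = 5: μ₀ = δ₀
        have hpt : μ₀ 0 = 1 := law_point_mass fM f1 fun k hk => by rcases hboth k hk with ⟨h | h | h, h' | h' | h'⟩ <;> omega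
        have z5 : μ₀ 5 = 0 := by by_contra hc; rcases hboth 5 hc with ⟨_, h' | h' | h'⟩ <;> omega
        simp only [show ¬ (5 : ℕ) ≤ 1 by norm_num, if_false, le_refl, if_true, Nat.sub_self, z5, hpt]
        refine ⟨Or.inr (by linarith), fun hz => ?_⟩
        exfalso; have : g = 0 := by linarith
        exact hg0.ne' this
      · exfalso
        exact law_supp_nonempty fM f1 fun k hk => by
          rcases hboth k hk with ⟨h | h | h, h' | h' | h'⟩ <;> omega

/-! ### Support `{1,2,6}`: a sure relay in front of `F₅(x)` -/

/-- **A CATERPILLAR LAW ON `{1,2,6}`** (no atom at `0`: a sure relay in front): the same region for `(ν 2, ν 6)`. [this work] -/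
theorem catBuilt_supp126 {x : ℝ} {N : ℕ} {ν : ℕ → ℝ} (h : CatBuilt x N ν) :
    (∀ k, ν k ≠ 0 → k = 1 ∨ k = 2 ∨ k = 6) → (ν 6 = 0 ∨ x ≤ ν 6) ∧ (ν 6 = 0 → ν 2 = 0 ∨ x ≤ ν 2) := by
  induction h with
  | nil x₀ hx0 hx1 => intro hs; exfalso; have := hs 0 (by simp); omega
  | @mono x₀ x' M₀ μ₀ h₀ hx'0 hxx ih =>
    intro hs
    obtain ⟨h6, h2⟩ := ih hs
    refine ⟨?_, fun hz => ?_⟩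
    · rcases h6 with h6 | h6
      · exact Or.inl h6
      · exact Or.inr (hxx.trans h6)
    · rcases h2 hz with h2 | h2
      · exact Or.inl h2
      · exact Or.inr (hxx.trans h2)
  | @gate x₀ M₀ μ₀ h₀ q hq0 hq1 ih =>
    intro hs
    have f0 := h₀.lawFacts.1
    rcases eq_or_lt_of_le hq1 with rfl | hq
    · rw [gate_one] at hs ⊢; rw [one_mul]; exact ih hs
    · exfalso; have := hs 0 (gate_zero_ne_zero f0 hq0.le hq); omega
  | @slice x₀ M₀ μ₀ h₀ a g hxg hg1 ih =>
    intro hs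
    obtain ⟨f0, fM, f1, _⟩ := h₀.lawFacts
    have hx0 : 0 < x₀ := h₀.floor.1
    have hx1 : x₀ < 1 := h₀.floor.2
    have hg0 : 0 < g := hx0.trans_le hxg
    obtain rfl | ha := Nat.eq_zero_or_pos a
    · rw [slice_zero_eq] at hs ⊢; exact ih hs
    rcases eq_or_lt_of_le hg1 with rfl | hg
    · have hsh : ∀ k, μ₀ k ≠ 0 → k + a = 1 ∨ k + a = 2 ∨ k + a = 6 := fun k hk => hs (k + a) (slice_ne_zero_right f0 one_pos le_rfl hk)
      have v2 : slice μ₀ a 1 2 = if a ≤ 2 then μ₀ (2 - a) else 0 := by simp only [slice]; ring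
      have v6 : slice μ₀ a 1 6 = if a ≤ 6 then μ₀ (6 - a) else 0 := by simp only [slice]; ring
      rw [v2, v6]
      obtain rfl | rfl | hother : a = 1 ∨ a = 2 ∨ 3 ≤ a := by omega
      · -- a = 1: μ₀ on {0,1,5}: region F₅ transported
        simp only [show (1 : ℕ) ≤ 2 by norm_num, if_true, show (1 : ℕ) ≤ 6 by norm_num, show 2 - 1 = 1 by norm_num, show 6 - 1 = 5 by norm_num]
        exact catBuilt_supp015 h₀ fun k hk => by rcases hsh k hk with h | h | h <;> omega
      · -- a = 2: μ₀ on {0,4}: region A₄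
        simp only [le_refl, if_true, Nat.sub_self, show (2 : ℕ) ≤ 6 by norm_num, show 6 - 2 = 4 by norm_num]
        have hs04 : ∀ k, μ₀ k ≠ 0 → k = 0 ∨ k = 4 := fun k hk => by rcases hsh k hk with h | h | h <;> omega
        have h4 := catBuilt_supp04 h₀ hs04
        have hm := law_mass_04 fM f1 hs04
        refine ⟨h4, fun hz => Or.inr ?_⟩
        rw [hz, add_zero] at hm; rw [hm]; exact hx1.le
      · rw [if_neg (show ¬ a ≤ 2 by omega)]
        by_cases ha6 : a ≤ 6
        · rw [if_pos ha6]
          have hpt : μ₀ (6 - a) = 1 := law_point_mass fM f1 fun k hk => by rcases hsh k hk with h | h | h <;> omega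
          rw [hpt]; exact ⟨Or.inr hx1.le, fun hz => absurd hz one_ne_zero⟩
        · rw [if_neg ha6]; simp
    · have hboth : ∀ k, μ₀ k ≠ 0 → (k = 1 ∨ k = 2 ∨ k = 6) ∧ (k + a = 1 ∨ k + a = 2 ∨ k + a = 6) :=
        fun k hk => ⟨hs k (slice_ne_zero_left f0 hg0.le hg hk), hs (k + a) (slice_ne_zero_right f0 hg0 hg1 hk)⟩
      have v2 : slice μ₀ a g 2 = (1 - g) * μ₀ 2 + g * (if a ≤ 2 then μ₀ (2 - a) else 0) := by simp only [slice]
      have v6 : slice μ₀ a g 6 = (1 - g) * μ₀ 6 + g * (if a ≤ 6 then μ₀ (6 - a) else 0) := by simp only [slice]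
      rw [v2, v6]
      obtain rfl | rfl | rfl | hother : a = 1 ∨ a = 4 ∨ a = 5 ∨ (a ≠ 1 ∧ a ≠ 4 ∧ a ≠ 5) := by omega
      · have hpt : μ₀ 1 = 1 := law_point_mass fM f1 fun k hk => by rcases hboth k hk with ⟨h | h | h, h' | h' | h'⟩ <;> omega
        have z2 : μ₀ 2 = 0 := by by_contra hc; rcases hboth 2 hc with ⟨_, h' | h' | h'⟩ <;> omega
        have z6 : μ₀ 6 = 0 := by by_contra hc; rcases hboth 6 hc with ⟨_, h' | h' | h'⟩ <;> omega
        have z5 : μ₀ 5 = 0 := by by_contra hc; rcases hboth 5 hc with ⟨h | h | h, _⟩ <;> omega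
        simp only [show (1 : ℕ) ≤ 2 by norm_num, if_true, show (1 : ℕ) ≤ 6 by norm_num, show 2 - 1 = 1 by norm_num, show 6 - 1 = 5 by norm_num,
          z2, z6, z5, hpt]
        refine ⟨Or.inl (by ring), fun _ => Or.inr (by linarith)⟩
      · have hpt : μ₀ 2 = 1 := law_point_mass fM f1 fun k hk => by rcases hboth k hk with ⟨h | h | h, h' | h' | h'⟩ <;> omega
        have z6 : μ₀ 6 = 0 := by by_contra hc; rcases hboth 6 hc with ⟨_, h' | h' | h'⟩ <;> omega
        simp only [show ¬ (4 : ℕ) ≤ 2 by norm_num, if_false, show (4 : ℕ) ≤ 6 by norm_num, if_true, show 6 - 4 = 2 by norm_num, z6, hpt]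
        refine ⟨Or.inr (by linarith), fun hz => ?_⟩
        exfalso; have : g = 0 := by linarith
        exact hg0.ne' this
      · have hpt : μ₀ 1 = 1 := law_point_mass fM f1 fun k hk => by rcases hboth k hk with ⟨h | h | h, h' | h' | h'⟩ <;> omega
        have z6 : μ₀ 6 = 0 := by by_contra hc; rcases hboth 6 hc with ⟨_, h' | h' | h'⟩ <;> omega
        simp only [show ¬ (5 : ℕ) ≤ 2 by norm_num, if_false, show (5 : ℕ) ≤ 6 by norm_num, if_true, show 6 - 5 = 1 by norm_num, z6, hpt]
        refine ⟨Or.inr (by linarith), fun hz => ?_⟩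
        exfalso; have : g = 0 := by linarith
        exact hg0.ne' this
      · exfalso
        exact law_supp_nonempty fM f1 fun k hk => by
          rcases hboth k hk with ⟨h | h | h, h' | h' | h'⟩ <;> omega

end LawDec
end Quant
end Summit.CriticalPhenomena.PercolationContinuityZ3.Theorems
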